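import Summits.NavierStokesRegularity.NavierStokesRegularity.Theorems.ScenarioCensusScrewBlowdown
import Literature.Analysis.FluidPDE.AxisymmetricSingularSetOnAxis
import HarnessLib

/-!
# LINE «screw-blowdown» port, part 2/12: §4 proved plumbing and S2 `BlowdownEnhancement` PROVED

Re-homed for the scenario census (typer seat ns-census-typer-1 g7; lead g9 RULINGS [7] 20:33Z / [8] 21:03Z / [12](b) 21:58Z: «screw-blowdown v1.8 =
version of record; `Row_A13isqT` DECIDED IN KERNEL → CANDIDATE-DECIDED member under A13 (row already TREE); typer-1 slot 3 port of record =
`ScrewBlowdown_port_v1_8.lean` bb5f719a8be448dd (stub-free)»; critic idea-crit-3 g6 CONFORMS ×3 21:38:50Z; ref PRE-CHECKs items 13 / 15 / 20):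
VERBATIM PORT of ns-idea-4 LINE g12-1 «screw-blowdown» PORT copy `pub/ideators/ns-idea-4/lines/screw-blowdown/port/ScrewBlowdown_port_v1_8.lean`
sha16 bb5f719a8be448dd (2660 l.; lean check rc 0, 0 sorry; = the v1.7 port copy 674e939b7b0b34e8 as a literal prefix + the `LocalPersistence`
attack appendix `…LP` + the consequences `localPersistence_holds` / `farPastSpreading_holds` / `linearConeLiouville_holds` / `row_A13isqT_proved`),
split for the 400-line rule into `ScenarioCensusScrewBlowdown` (§1–§3: objects, the cell `Row_A13isqT`, obligation Props, S1 PROVED) →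
`…Plumbing` (§4, S2 PROVED) → `…Bridges` (§5 + v1.3) → `…Recurrent` (v1.4, `Row_ArecT`) → `…OffAxis` (v1.5 a) → `…Cone` (v1.5 b:
`farPast_linearCone_smallness_of_screw`) → `…Residual` (v1.5 c + v1.6: `LinearConeLiouville`, DSS rungs) → `…Propagation` (v1.7: FS, LP,
reductions; the three class-general tools are NOT re-declared — taken BY NAME, general `E`, from `Theorems/TypeIAncientMildForwardUniqueness.lean`,
ns-idea-4 extract a1b589f6dec7da83, p671177) → `…LPTools` / `…LPDuhamel` / `…LP` (the appendix: Gaussian locality, the three-term Oseen split,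
time weights; `duhamel_bound`; the bootstrap `one_step` / `persist` / `localPersistence` + the consequences incl. `row_A13isqT_proved`) →
`…Keys` (census keys).  Lean text VERBATIM in namespaces `…Theorems.ScenarioCensus.ScrewBlowdown` / `…ScrewBlowdownLP` (the line's
`…Lines.ScrewBlowdownPort` / `…PortLP` re-homed; qualified references renamed accordingly); port edits: `local notation "E3"` → `abbrev E3` (the
appendix `open`s it), `@[conjecture]` on the two Props still OPEN in this copy (`Row_ArecT`, `VanishingBlowdownLiouville`; v1.9 proves them
files-only, not of record here), four one-line docstrings added, `continuous_rotZ_angle'` not re-declared (it restates the tree's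
`Literature.Analysis.FluidPDE.continuous_rotZ_angle`, gate lint `dedup.landed`; its uses renamed), the line's `set_option linter.unusedVariables false` dropped (five proof lambdas
bind the unused `θ₀ h` as `_ _`; the unused hypothesis binder of `hasVanishingBlowdown_of_axiallyRecurrent` is spelled `_hu`, statement otherwise
identical); `set_option maxHeartbeats … in` of the appendix kept as in the line.

No census VALUE is moved by this file (row A13 is TREE already; the lead books the member A13isq-T); NS regularity is NOT proved; (L′)
`SymmetryModuliCount.TypeIAncientLiouville` is untouched (hypothesis of bridges only); no summit statement is proved by this file.
-/

-- the summit and its single problem share the name `NavierStokesRegularity` (D-0017 nested layout)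
set_option linter.dupNamespace false

namespace Summit.NavierStokesRegularity.NavierStokesRegularity.Theorems.ScenarioCensus.ScrewBlowdown

open Set Function Filter Topology
open Literature.Analysis Literature.Analysis.FluidPDE
open Summit.NavierStokesRegularity.NavierStokesRegularity.Theorems

/-! ## §4 Proved plumbing -/

/-- `e₃ ≠ 0`. -/
theorem eZ_ne_zero : (eZ : E3) ≠ 0 := by
  intro h
  have := congrArg (fun v : E3 => v 2) h
  simp [eZ] at this

/-- Cylinder-invariant class elements are line-invariant along `e₃`, hence ZERO (tree engine BY NAME:
`AxisTwistDoorTiltDominationLocSymmetryExclusions.eq_zero_of_typeIAncientMild_of_lineInvariant`). -/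
theorem cylinderInvariant_eq_zero {C : ℝ} {W : ℝ → E3 → E3} (hW : IsTypeIAncientMild C W)
    (hcyl : IsCylinderInvariant W) : ∀ t < (0 : ℝ), ∀ x, W t x = 0 := by
  refine AxisTwistDoorTiltDominationLocSymmetryExclusions.eq_zero_of_typeIAncientMild_of_lineInvariant hW
    eZ_ne_zero fun t ht x r => ?_
  have h := hcyl 0 r t ht x
  simpa [rotZ_zero] using h

/-- The parabolic zoom of a screw-equivariant field is equivariant under the RESCALED screw
`(R_θ, (h/μ) e₃)`: the deck group contracts towards the rotation group as `μ → ∞`. -/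
theorem isScrewEquivariant_nsRescale {θ h μ : ℝ} {u : ℝ → E3 → E3} (hμ : μ ≠ 0)
    (hu : IsScrewEquivariant θ h u) : IsScrewEquivariant θ (h / μ) (nsRescale μ u) := by
  intro t ht x
  have ht' : μ ^ 2 * t < 0 := mul_neg_of_pos_of_neg (by positivity) ht
  have key := hu (μ ^ 2 * t) ht' (μ • x)
  simp only [nsRescale]
  have e1 : μ • (rotZ θ x + (h / μ) • eZ) = rotZ θ (μ • x) + h • eZ := by
    rw [smul_add, smul_smul, mul_div_cancel₀ _ hμ, rotZ_smul]
  rw [e1, key, rotZ_smul]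

/-- Iterating the screw: the `n`-th power `(R_{nθ}, nh e₃)`, `n : ℕ`. -/
theorem isScrewEquivariant_iterate {θ h : ℝ} {u : ℝ → E3 → E3} (hu : IsScrewEquivariant θ h u) :
    ∀ n : ℕ, IsScrewEquivariant (n * θ) (n * h) u := by
  intro n
  induction n with
  | zero =>
      intro t ht x
      simp [rotZ_zero]
  | succ k ih =>
      intro t ht x
      have h1 := hu t ht (rotZ (k * θ) x + (k * h) • eZ)
      have e1 : rotZ θ (rotZ (↑k * θ) x + (↑k * h) • eZ) + h • eZ =
          rotZ ((↑(k + 1) : ℝ) * θ) x + ((↑(k + 1) : ℝ) * h) • eZ := by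
        have lin : rotZ θ (rotZ (↑k * θ) x + (↑k * h) • eZ) = rotZ θ (rotZ (↑k * θ) x) + (↑k * h) • rotZ θ eZ := by
          ext i; fin_cases i <;> simp [rotZ, eZ, mul_add]
        have fix : rotZ θ eZ = eZ := by
          ext i; fin_cases i <;> simp [rotZ, eZ]
        rw [lin, fix, ← rotZ_add]
        have : θ + ↑k * θ = (↑(k + 1) : ℝ) * θ := by push_cast; ring
        rw [this, add_assoc, ← add_smul]
        congr 2; push_cast; ring
      rw [e1] at h1
      rw [h1, ih t ht x, ← rotZ_add]
      congr 1; push_cast; ring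

/-- Blow-down limits EXIST along a subsequence of any sequence of scales (tree extraction
`exists_tendsto_of_isTypeIAncientMild_seq` applied to the zooms, which stay in the class by
`IsTypeIAncientMild.nsRescale`): the notion `IsBlowdownLimit` is not vacuous. -/
theorem exists_blowdownLimit {C : ℝ} {u : ℝ → E3 → E3} (hu : IsTypeIAncientMild C u)
    (μ : ℕ → ℝ) (hμ : ∀ k, 0 < μ k) (hμ' : Tendsto μ atTop atTop) :
    ∃ W, IsBlowdownLimit C u W := by
  obtain ⟨φ, hφ, W, hW, -, -, hloc, -⟩ :=
    exists_tendsto_of_isTypeIAncientMild_seq C (w := fun k => nsRescale (μ k) u)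
      fun k => isTypeIAncientMild_nsRescale hu (hμ k)
  exact ⟨W, hW, fun k => μ (φ k), fun k => hμ _, hμ'.comp hφ.tendsto_atTop, fun t ht => hloc t ht⟩

/-! ### S2 — PROVED (v1.2): Kronecker recurrence along the shrinking pitch + the tree's mode of convergence
(locally uniform on slices) + continuity of class slices.  Soft argument: a convergent sub-subsequence of the
return angles (Bolzano–Weierstrass), then the window `δ → 0`. -/

/-- `2π`-periodicity of the rotation in the angle. -/
theorem rotZ_add_int_mul_two_pi (θ : ℝ) (j : ℤ) (x : E3) :
    rotZ (θ + j * (2 * Real.pi)) x = rotZ θ x := by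
  ext i
  fin_cases i <;> simp [rotZ, Real.cos_add_int_mul_two_pi, Real.sin_add_int_mul_two_pi]

-- `continuous_rotZ_angle'`: the line restates `Literature.Analysis.FluidPDE.continuous_rotZ_angle` (tree); taken BY NAME (gate lint dedup.landed).

/-- `R_θ` is additive (used as `R_θ (p − q) = R_θ p − R_θ q`). -/
theorem rotZ_sub_vec (θ : ℝ) (p q : E3) : rotZ θ (p - q) = rotZ θ p - rotZ θ q := by
  ext i; fin_cases i <;> simp [rotZ] <;> ring

/-- Joint limit `R_{θ_i} v_i → R_a w` from `θ_i → a`, `v_i → w` (isometry `norm_rotZ` + continuity in the angle;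
stated without the product topology to keep elaboration cheap). -/
theorem tendsto_rotZ_of_tendsto {θ : ℕ → ℝ} {v : ℕ → E3} {a : ℝ} {w : E3} (hθ : Tendsto θ atTop (𝓝 a))
    (hv : Tendsto v atTop (𝓝 w)) : Tendsto (fun i => rotZ (θ i) (v i)) atTop (𝓝 (rotZ a w)) := by
  have hsplit : ∀ i, rotZ (θ i) (v i) = rotZ (θ i) (v i - w) + rotZ (θ i) w := by
    intro i; rw [rotZ_sub_vec]; abel
  have h2 : Tendsto (fun i => rotZ (θ i) w) atTop (𝓝 (rotZ a w)) :=
    ((continuous_rotZ_angle w).tendsto a).comp hθ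
  have h1 : Tendsto (fun i => rotZ (θ i) (v i - w)) atTop (𝓝 0) := by
    rw [tendsto_zero_iff_norm_tendsto_zero]
    have : Tendsto (fun i => ‖v i - w‖) atTop (𝓝 0) := by
      rw [← tendsto_iff_norm_sub_tendsto_zero]; exact hv
    refine this.congr fun i => ?_
    rw [norm_rotZ]
  have := h1.add h2
  rw [zero_add] at this
  exact this.congr fun i => (hsplit i).symm

/-- A subsequence of a locally uniformly convergent sequence converges locally uniformly. -/
theorem tendstoLocallyUniformly_subseq {F : ℕ → E3 → E3} {f : E3 → E3}
    (hF : TendstoLocallyUniformly F f atTop) {ψ : ℕ → ℕ} (hψ : StrictMono ψ) :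
    TendstoLocallyUniformly (fun i => F (ψ i)) f atTop := by
  intro U hU x
  obtain ⟨V, hV, hev⟩ := hF U hU x
  exact ⟨V, hV, hψ.tendsto_atTop.eventually hev⟩

/-- Arithmetic of the return window (Step 1a of S2): above `⌈sμ/h⌉` (non-negative when `s/h ≥ 0`) there is a
return time `n ∈ ℕ` of the rotation within `δ` of the target angle, with `|n h − s μ| ≤ (N+1)|h|`. -/
theorem exists_return_in_window {θ₀ h δ φ s μk : ℝ} {N : ℕ} (hh : h ≠ 0)
    (hwin : ∀ (φ : ℝ) (m : ℤ), ∃ n : ℤ, m ≤ n ∧ n < m + N ∧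
      ∃ k : ℤ, |(n : ℝ) * θ₀ - (k : ℝ) * (2 * Real.pi) - φ| < δ)
    (hs : 0 ≤ s / h) (hμk : 0 < μk) :
    ∃ n : ℕ, ∃ j : ℤ, |(n : ℝ) * h - s * μk| ≤ ((N : ℝ) + 1) * |h| ∧
      |(n : ℝ) * θ₀ - (j : ℝ) * (2 * Real.pi) - φ| < δ := by
  obtain ⟨n, hmn, hnm, j, hj⟩ := hwin φ ⌈s * μk / h⌉
  have hq0 : 0 ≤ s * μk / h := by
    rw [mul_div_right_comm]
    exact mul_nonneg hs hμk.le
  have hm0 : (0 : ℤ) ≤ ⌈s * μk / h⌉ := Int.ceil_nonneg hq0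
  have hn0 : 0 ≤ n := hm0.trans hmn
  have hcast : ((n.toNat : ℕ) : ℝ) = (n : ℝ) := by
    have : ((n.toNat : ℕ) : ℤ) = n := Int.toNat_of_nonneg hn0
    exact_mod_cast this
  refine ⟨n.toNat, j, ?_, by rw [hcast]; exact hj⟩
  rw [hcast]
  have hm1 : ((⌈s * μk / h⌉ : ℤ) : ℝ) < s * μk / h + 1 := Int.ceil_lt_add_one _
  have hm2 : s * μk / h ≤ ((⌈s * μk / h⌉ : ℤ) : ℝ) := Int.le_ceil _
  have hnm' : (n : ℝ) < ((⌈s * μk / h⌉ : ℤ) : ℝ) + N := by exact_mod_cast hnm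
  have hmn' : ((⌈s * μk / h⌉ : ℤ) : ℝ) ≤ n := by exact_mod_cast hmn
  have key : |(n : ℝ) - s * μk / h| ≤ (N : ℝ) + 1 := by
    rw [abs_le]; constructor <;> linarith
  have e : (n : ℝ) * h - s * μk = ((n : ℝ) - s * μk / h) * h := by
    field_simp
  rw [e, abs_mul]
  gcongr

/-- Step 1b of S2: shifts `s_k = n_k h / μ_k` with `|n_k h − s μ_k| ≤ B` converge to `s` as `μ_k → ∞`. -/
theorem tendsto_shift {h s B : ℝ} {μ : ℕ → ℝ} {n : ℕ → ℕ} (hμ : ∀ k, 0 < μ k) (hμ' : Tendsto μ atTop atTop)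
    (hB : ∀ k, |(n k : ℝ) * h - s * μ k| ≤ B) :
    Tendsto (fun k => (n k : ℝ) * h / μ k) atTop (𝓝 s) := by
  have hbound : ∀ k, |(n k : ℝ) * h / μ k - s| ≤ B * (μ k)⁻¹ := by
    intro k
    have hμk := hμ k
    have e : (n k : ℝ) * h / μ k - s = ((n k : ℝ) * h - s * μ k) / μ k := by
      field_simp
    rw [e, abs_div, abs_of_pos hμk, div_eq_mul_inv]
    gcongr
    exact hB k
  have h0 : Tendsto (fun k => B * (μ k)⁻¹) atTop (𝓝 0) := by
    simpa using (hμ'.inv_tendsto_atTop).const_mul B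
  rw [tendsto_iff_norm_sub_tendsto_zero]
  exact squeeze_zero (fun k => norm_nonneg _) (fun k => by rw [Real.norm_eq_abs]; exact hbound k) h0

/-- Step 1 of S2 (approximate angle): for axial shifts `s` with `s/h ≥ 0` and every window `δ > 0` there is an
angle `a`, `|a − φ| ≤ δ`, with `W(t, R_a x + s e₃) = R_a W(t, x)`. -/
theorem approx_cylinder_invariance (h1 : SyndeticReturn) {C : ℝ} {u W : ℝ → E3 → E3} {θ₀ h : ℝ}
    (hirr : Irrational (θ₀ / (2 * Real.pi))) (hh : h ≠ 0) (hS : IsScrewEquivariant θ₀ h u)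
    (hW : IsTypeIAncientMild C W) {μ : ℕ → ℝ} (hμ : ∀ k, 0 < μ k) (hμ' : Tendsto μ atTop atTop)
    (hconv : ∀ t < (0 : ℝ), TendstoLocallyUniformly (fun k => nsRescale (μ k) u t) (W t) atTop)
    {s : ℝ} (hs : 0 ≤ s / h) (φ : ℝ) {t : ℝ} (ht : t < 0) (x : E3) {δ : ℝ} (hδ : 0 < δ) :
    ∃ a : ℝ, |a - φ| ≤ δ ∧ W t (rotZ a x + s • eZ) = rotZ a (W t x) := by
  obtain ⟨N, hN, hwin⟩ := h1 θ₀ hirr δ hδ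
  have hchoice : ∀ k : ℕ, ∃ n : ℕ, ∃ j : ℤ, |(n : ℝ) * h - s * μ k| ≤ ((N : ℝ) + 1) * |h| ∧
      |(n : ℝ) * θ₀ - (j : ℝ) * (2 * Real.pi) - φ| < δ :=
    fun k => exists_return_in_window hh hwin hs (hμ k)
  choose n j hnj using hchoice
  obtain ⟨φk, hφk⟩ : ∃ φk : ℕ → ℝ, ∀ k, φk k = (n k : ℝ) * θ₀ - (j k : ℝ) * (2 * Real.pi) :=
    ⟨_, fun k => rfl⟩
  obtain ⟨sk, hsk⟩ : ∃ sk : ℕ → ℝ, ∀ k, sk k = (n k : ℝ) * h / μ k := ⟨_, fun k => rfl⟩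
  -- the rescaled fields are equivariant under the iterated rescaled screw `(R_{φ_k}, s_k e₃)`
  have hEq : ∀ k, nsRescale (μ k) u t (rotZ (φk k) x + sk k • eZ) = rotZ (φk k) (nsRescale (μ k) u t x) := by
    intro k
    have h0 := isScrewEquivariant_iterate (isScrewEquivariant_nsRescale (hμ k).ne' hS) (n k) t ht x
    have hper : ∀ y, rotZ ((n k : ℝ) * θ₀) y = rotZ (φk k) y := by
      intro y
      rw [← rotZ_add_int_mul_two_pi (φk k) (j k) y, hφk k]
      congr 1; ring
    have hs' : (n k : ℝ) * (h / μ k) = sk k := by rw [hsk k]; ring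
    rw [hper, hper, hs'] at h0
    exact h0
  -- the return angles stay in the window: extract a convergent subsequence
  have hbd : ∀ k, φk k ∈ Icc (φ - δ) (φ + δ) := fun k => by
    have hk := (hnj k).2
    rw [← hφk k] at hk
    rw [abs_lt] at hk
    constructor <;> linarith [hk.1, hk.2]
  obtain ⟨a, ha, ψ, hψ, hφa⟩ := tendsto_subseq_of_bounded (Metric.isBounded_Icc (φ - δ) (φ + δ)) hbd
  rw [closure_Icc] at ha
  refine ⟨a, by rw [abs_le]; constructor <;> linarith [ha.1, ha.2], ?_⟩
  -- the axial shifts converge to `s`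
  have hsk_lim : Tendsto sk atTop (𝓝 s) := by
    have := tendsto_shift (s := s) hμ hμ' (fun k => (hnj k).1)
    refine this.congr fun k => ?_
    rw [hsk k]
  -- pass to the limit along `ψ` on both sides of `hEq`
  have hcontW : Continuous (W t) := hW.continuous_slice ht
  have hsub : TendstoLocallyUniformly (fun i => nsRescale (μ (ψ i)) u t) (W t) atTop :=
    tendstoLocallyUniformly_subseq (hconv t ht) hψ
  have hy : Tendsto (fun i => rotZ (φk (ψ i)) x + sk (ψ i) • eZ) atTop (𝓝 (rotZ a x + s • eZ)) :=
    (((continuous_rotZ_angle x).tendsto a).comp hφa).add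
      ((hsk_lim.comp hψ.tendsto_atTop).smul_const eZ)
  have hL : Tendsto (fun i => nsRescale (μ (ψ i)) u t (rotZ (φk (ψ i)) x + sk (ψ i) • eZ)) atTop
      (𝓝 (W t (rotZ a x + s • eZ))) :=
    hsub.tendsto_comp hcontW.continuousAt hy
  have hxx : Tendsto (fun _ : ℕ => x) atTop (𝓝 x) := tendsto_const_nhds
  have hpt : Tendsto (fun i => nsRescale (μ (ψ i)) u t x) atTop (𝓝 (W t x)) :=
    TendstoLocallyUniformly.tendsto_comp (g := fun _ : ℕ => x) hsub hcontW.continuousAt hxx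
  have hφa' : Tendsto (fun i => φk (ψ i)) atTop (𝓝 a) := hφa
  have hR : Tendsto (fun i => rotZ (φk (ψ i)) (nsRescale (μ (ψ i)) u t x)) atTop (𝓝 (rotZ a (W t x))) :=
    tendsto_rotZ_of_tendsto hφa' hpt
  have hL' : Tendsto (fun i => rotZ (φk (ψ i)) (nsRescale (μ (ψ i)) u t x)) atTop
      (𝓝 (W t (rotZ a x + s • eZ))) :=
    hL.congr fun i => hEq (ψ i)
  exact tendsto_nhds_unique hL' hR

/-- Step 2 of S2: exact invariance for axial shifts with `s/h ≥ 0` (window `δ → 0`, continuity). -/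
theorem cylinder_invariance_of_nonneg (h1 : SyndeticReturn) {C : ℝ} {u W : ℝ → E3 → E3} {θ₀ h : ℝ}
    (hirr : Irrational (θ₀ / (2 * Real.pi))) (hh : h ≠ 0) (hS : IsScrewEquivariant θ₀ h u)
    (hW : IsTypeIAncientMild C W) {μ : ℕ → ℝ} (hμ : ∀ k, 0 < μ k) (hμ' : Tendsto μ atTop atTop)
    (hconv : ∀ t < (0 : ℝ), TendstoLocallyUniformly (fun k => nsRescale (μ k) u t) (W t) atTop)
    {s : ℝ} (hs : 0 ≤ s / h) (φ : ℝ) {t : ℝ} (ht : t < 0) (x : E3) :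
    W t (rotZ φ x + s • eZ) = rotZ φ (W t x) := by
  have hA : ∀ i : ℕ, ∃ a : ℝ, |a - φ| ≤ 1 / ((i : ℝ) + 1) ∧ W t (rotZ a x + s • eZ) = rotZ a (W t x) :=
    fun i => approx_cylinder_invariance h1 hirr hh hS hW hμ hμ' hconv hs φ ht x (by positivity)
  choose a ha using hA
  have hlim : Tendsto a atTop (𝓝 φ) := by
    rw [tendsto_iff_norm_sub_tendsto_zero]
    exact squeeze_zero (fun i => norm_nonneg _) (fun i => by rw [Real.norm_eq_abs]; exact (ha i).1)
      tendsto_one_div_add_atTop_nhds_zero_nat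
  have hcontW : Continuous (W t) := hW.continuous_slice ht
  have hL : Tendsto (fun i => W t (rotZ (a i) x + s • eZ)) atTop (𝓝 (W t (rotZ φ x + s • eZ))) :=
    (hcontW.tendsto _).comp ((((continuous_rotZ_angle x).tendsto φ).comp hlim).add tendsto_const_nhds)
  have hR : Tendsto (fun i => rotZ (a i) (W t x)) atTop (𝓝 (rotZ φ (W t x))) :=
    ((continuous_rotZ_angle (W t x)).tendsto φ).comp hlim
  exact tendsto_nhds_unique (hL.congr fun i => (ha i).2) hR

/-- S2 (M-sized) — PROVED in v1.2 (name `stub_` kept so that the registered composition is unchanged):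
negative axial shifts follow from the non-negative ones by evaluating at a translated point. -/
theorem stub_blowdownEnhancement : SyndeticReturn → BlowdownEnhancement := by
  intro h1 C u θ₀ h hu hirr hh hS W hW
  obtain ⟨hWc, μ, hμ, hμ', hconv⟩ := hW
  intro φ s t ht x
  by_cases hs : 0 ≤ s / h
  · exact cylinder_invariance_of_nonneg h1 hirr hh hS hWc hμ hμ' hconv hs φ ht x
  · have hs' : 0 ≤ -s / h := by
      rw [neg_div]; linarith [lt_of_not_ge hs]
    have e1 := cylinder_invariance_of_nonneg h1 hirr hh hS hWc hμ hμ' hconv hs' 0 ht (rotZ φ x + s • eZ)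
    have e2 := cylinder_invariance_of_nonneg h1 hirr hh hS hWc hμ hμ' hconv (s := 0) (by simp) φ ht x
    rw [rotZ_zero, rotZ_zero, neg_smul, add_neg_cancel_right] at e1
    rw [zero_smul, add_zero] at e2
    rw [← e1, e2]

/-- **Every blow-down of an irrational-screw candidate vanishes** (S1 → S2 → tree): the census content of the
line. -/
theorem hasVanishingBlowdown_of_screw (h1 : SyndeticReturn) (h2 : SyndeticReturn → BlowdownEnhancement)
    {C : ℝ} {u : ℝ → E3 → E3} {θ₀ h : ℝ} (hu : IsTypeIAncientMild C u)
    (hθ : Irrational (θ₀ / (2 * Real.pi))) (hh : h ≠ 0) (hS : IsScrewEquivariant θ₀ h u) :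
    HasVanishingBlowdown C u :=
  fun W hW => cylinderInvariant_eq_zero hW.1 (h2 h1 C u θ₀ h hu hθ hh hS W hW)

/-- **v1.2 — UNCONDITIONAL census theorem of the line**: every blow-down limit (in its class, along parabolic
zoom-outs) of a Type-I ancient mild field equivariant under a discrete screw of irrational turn is identically
zero.  (S1 and S2 are proved; no sorry is used — see the axiom audit of this declaration.) -/
theorem hasVanishingBlowdown_of_screw' {C : ℝ} {u : ℝ → E3 → E3} {θ₀ h : ℝ} (hu : IsTypeIAncientMild C u)
    (hθ : Irrational (θ₀ / (2 * Real.pi))) (hh : h ≠ 0) (hS : IsScrewEquivariant θ₀ h u) :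
    HasVanishingBlowdown C u :=
  hasVanishingBlowdown_of_screw stub_syndeticReturn stub_blowdownEnhancement hu hθ hh hS

/-- v1.2: the cell reduces to the single research residual S3. -/
theorem row_A13isqT_of_vanishingBlowdownLiouville (h3 : VanishingBlowdownLiouville) : Row_A13isqT :=
  fun C u _ _ hu hθ hh hS => h3 C u hu (hasVanishingBlowdown_of_screw' hu hθ hh hS)

end Summit.NavierStokesRegularity.NavierStokesRegularity.Theorems.ScenarioCensus.ScrewBlowdown
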